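import Mathlib.Analysis.LocallyConvex.HahnBanach
import Mathlib.Analysis.Normed.Ring.Units
import Mathlib.Analysis.Calculus.FDeriv.Prod
import Mathlib.Analysis.Calculus.FDeriv.Add
import Mathlib.Analysis.Calculus.FDeriv.Linear
import Mathlib.Analysis.Analytic.Constructions
import Literature.Analysis.Complex.OsgoodProofs
import HarnessLib

/-!
# Holomorphic frames for a continuous family of kernels from pointwise `ℂ`-differentiability

Topic `Literature/Analysis/Complex` (several complex variables; the finite-dimensional end of the
proof that the period map is holomorphic, C. Voisin, *Hodge Theory and Complex Algebraic Geometry I*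
(2002), Thm. 10.9: "To see that it is holomorphic, it now suffices to show that its differential is
`ℂ`-linear", read in the graph charts of the Grassmannian, Prop. 10.5). Theorems only.

Let `V` be a finite-dimensional complex normed space, `U ⊆ ℂᵈ` open and `P : U → {subspaces of V}`
a family of subspaces of constant dimension `r` which is *continuous* in the weakest usable sense:
`P t = ker L t` for a family of continuous linear maps `L t : V → H` into a fixed normed space,
depending continuously on `t` (`H` may be infinite-dimensional, e.g. a pre-Hilbert space of
differential forms). Suppose that at EVERY `t ∈ U` finitely many linear functionals `ℓ_j` with
`⋂ ker ℓ_j ⊆ P t` are given such that for every `V`-valued map `σ`, continuous at `t` and with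
`σ t' ∈ P t'` for `t'` near `t`, the scalar functions `t' ↦ ℓ_j (σ t')` are complex (Fréchet)
differentiable AT `t`. Then `P` admits local holomorphic frames: near every `t₀ ∈ U` there are
`r` analytic maps `w_i : ℂᵈ → V` with `w_1 t, …, w_r t` a basis of `P t`
(`exists_analyticOnNhd_frame_of_ker_of_differentiableAt`).

Proof. Compose `L t` with a continuous projection onto the finite-dimensional `range L t₀`
(Hahn–Banach, `Submodule.ClosedComplemented.of_finiteDimensional`); on a complement `C` of
`K = P t₀` the composite is invertible at `t₀`, hence (units are open) near `t₀`, where a dimension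
count gives `P t = ker` of the composite and `P t = graph φ_t` for a continuous `φ_t : K → C`. For
`u ∈ K` the section `t' ↦ u + φ_{t'} u` is continuous with values in `P`, so every `ℓ_j ∘ φ u` is
`ℂ`-differentiable at every point; the `ℓ_j` separate `C` (as `C ∩ P t = 0`), so `φ u` is
`ℂ`-differentiable on an open set, hence analytic by Osgood's lemma (the tree's
`Literature.Analysis.Complex.osgoodLemma_holds`, Hörmander Thms. 2.2.1/2.2.6, made vector valued by
coordinates: `analyticOnNhd_of_differentiableOn_of_finiteDimensional`).

## References

* C. Voisin, *Hodge Theory and Complex Algebraic Geometry I*, CUP (2002), §10.1.1 Prop. 10.5,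
  §10.1.2 Thm. 10.9. [VoisinHodgeI2002]
* L. Hörmander, *An Introduction to Complex Analysis in Several Variables* (1973), Thm. 2.2.1,
  Thm. 2.2.6. [HormanderSCV1973]
-/

noncomputable section

open Set Filter Function Module Topology

namespace Literature.Analysis.Complex

variable {V : Type*} [NormedAddCommGroup V] [NormedSpace ℂ V] [FiniteDimensional ℂ V]

/-! ### Vector-valued Osgood -/

/-- **Osgood's lemma, vector valued**: a map from an open subset of a finite-dimensional complex
normed space to a finite-dimensional complex normed space which is complex differentiable is
analytic (coordinates with respect to a basis reduce to the scalar case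
`Literature.Analysis.Complex.osgoodLemma_holds`). [cite: HormanderSCV1973, Thm 2.2.1 and Thm 2.2.6] -/
theorem analyticOnNhd_of_differentiableOn_of_finiteDimensional {E : Type*} [NormedAddCommGroup E]
    [NormedSpace ℂ E] [FiniteDimensional ℂ E] {f : E → V} {U : Set E} (hU : IsOpen U)
    (hf : DifferentiableOn ℂ f U) : AnalyticOnNhd ℂ f U := by
  classical
  let b := Module.finBasis ℂ V
  have hcoord : ∀ i, AnalyticOnNhd ℂ (fun x ↦ b.coord i (f x)) U := fun i ↦
    osgoodLemma_holds E hU ((b.coord i).toContinuousLinearMap.differentiable.comp_differentiableOn hf)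
  have hsum : AnalyticOnNhd ℂ (fun x ↦ ∑ i, (b.coord i (f x)) • b i) U :=
    Finset.univ.analyticOnNhd_fun_sum fun i _ ↦ (hcoord i).smul analyticOnNhd_const
  have heq : (fun x ↦ ∑ i, (b.coord i (f x)) • b i) = f := funext fun x ↦ b.sum_repr (f x)
  rwa [heq] at hsum

/-! ### Graph coordinates of a continuous family of kernels -/

/-- A complex-differentiable map into a finite-dimensional space is detected by a finite family
of linear functionals with trivial common kernel: if `t ↦ ℓ_j (f t)` is differentiable at `t` for
all `j` and `⋂ ker ℓ_j = 0`, then `f` is differentiable at `t`. [folklore] -/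
theorem differentiableAt_of_forall_clm {E : Type*} [NormedAddCommGroup E] [NormedSpace ℂ E]
    {C : Type*} [NormedAddCommGroup C] [NormedSpace ℂ C] [FiniteDimensional ℂ C]
    {m : ℕ} (ℓ : Fin m → C →L[ℂ] ℂ) (hsep : ∀ c : C, (∀ j, ℓ j c = 0) → c = 0)
    {f : E → C} {t : E} (hf : ∀ j, DifferentiableAt ℂ (fun t' ↦ ℓ j (f t')) t) :
    DifferentiableAt ℂ f t := by
  -- the injective linear map `J : C → ℂᵐ`, `c ↦ (ℓ_j c)_j`, and a linear left inverse `G`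
  let J : C →ₗ[ℂ] (Fin m → ℂ) := LinearMap.pi fun j ↦ (ℓ j : C →ₗ[ℂ] ℂ)
  have hJ : LinearMap.ker J = ⊥ := by
    rw [LinearMap.ker_eq_bot']
    intro c hc
    exact hsep c fun j ↦ by simpa [J] using congr_fun hc j
  obtain ⟨G, hG⟩ := J.exists_leftInverse_of_injective hJ
  have hJf : DifferentiableAt ℂ (fun t' ↦ J (f t')) t := by
    rw [differentiableAt_pi]
    intro j
    simpa [J] using hf j
  have hGJ : (fun t' ↦ G (J (f t'))) = f := funext fun t' ↦ by
    simpa using LinearMap.congr_fun hG (f t')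
  rw [← hGJ]
  exact (G.toContinuousLinearMap.differentiableAt).comp t hJf

/-- **Holomorphic frames for a continuous family of kernels of constant dimension from pointwise
`ℂ`-differentiability against separating functionals** (the finite-dimensional end of Griffiths'
theorem, Voisin (2002) Thm. 10.9 read in the graph charts of Prop. 10.5; see the module
docstring for the statement in words and the proof). [cite: VoisinHodgeI2002, §10.1.2 Thm. 10.9] -/
theorem exists_analyticOnNhd_frame_of_ker_of_differentiableAt {d : ℕ}
    {H : Type*} [NormedAddCommGroup H] [NormedSpace ℂ H]
    {U : Set (Fin d → ℂ)} (hU : IsOpen U)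
    (P : (Fin d → ℂ) → Submodule ℂ V) (L : (Fin d → ℂ) → V →L[ℂ] H)
    (hL : ContinuousOn L U) (hP : ∀ t ∈ U, P t = LinearMap.ker (L t : V →ₗ[ℂ] H))
    {r : ℕ} (hr : ∀ t ∈ U, finrank ℂ (P t) = r)
    (hdiff : ∀ t ∈ U, ∃ (m : ℕ) (ℓ : Fin m → V →L[ℂ] ℂ),
      (∀ v, (∀ j, ℓ j v = 0) → v ∈ P t) ∧
      ∀ j, ∀ σ : (Fin d → ℂ) → V, ContinuousAt σ t → (∀ᶠ t' in 𝓝 t, σ t' ∈ P t') →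
        DifferentiableAt ℂ (fun t' ↦ ℓ j (σ t')) t)
    {t₀ : Fin d → ℂ} (ht₀ : t₀ ∈ U) :
    ∃ U₀ : Set (Fin d → ℂ), IsOpen U₀ ∧ t₀ ∈ U₀ ∧ U₀ ⊆ U ∧
      ∃ w : Fin r → (Fin d → ℂ) → V, (∀ i, AnalyticOnNhd ℂ (w i) U₀) ∧
        ∀ t ∈ U₀, LinearIndependent ℂ (fun i ↦ w i t) ∧
          Submodule.span ℂ (Set.range fun i ↦ w i t) = P t := by
  classical
  -- the finite-dimensional target `R₀ = range (L t₀)` and a continuous projection `Q` onto it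
  set R₀ : Submodule ℂ H := LinearMap.range (L t₀ : V →ₗ[ℂ] H) with hR₀
  haveI : FiniteDimensional ℂ R₀ := LinearMap.finiteDimensional_range _
  obtain ⟨Q, hQ⟩ := Submodule.ClosedComplemented.of_finiteDimensional R₀
  -- `M t = Q ∘ L t : V → R₀`, continuous in `t`
  set M : (Fin d → ℂ) → V →L[ℂ] R₀ := fun t ↦ Q.comp (L t) with hM
  have hMc : ContinuousOn M U := (ContinuousLinearMap.compL ℂ V H R₀ Q).continuous.comp_continuousOn hL
  have hMker : ∀ t ∈ U, P t ≤ LinearMap.ker (M t : V →ₗ[ℂ] R₀) := by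
    intro t ht v hv
    rw [hP t ht] at hv
    simp only [LinearMap.mem_ker, ContinuousLinearMap.coe_coe] at hv ⊢
    simp [hM, hv]
  -- `K = P t₀` and a complement `C`
  set K : Submodule ℂ V := P t₀ with hK
  obtain ⟨C, hKC⟩ := K.exists_isCompl
  -- the block `A t = M t|_C : C → R₀`; it is bijective at `t₀`
  set A : (Fin d → ℂ) → C →L[ℂ] R₀ := fun t ↦ (M t).comp C.subtypeL with hA
  have hAinj₀ : Function.Injective (A t₀) := by
    refine (injective_iff_map_eq_zero (A t₀)).2 fun c hc ↦ ?_
    have h1 : L t₀ c ∈ R₀ := LinearMap.mem_range_self _ _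
    have h2 : Q (L t₀ c) = 0 := by simpa [hA, hM] using hc
    have h3 : (L t₀ c : H) = 0 := by
      have := hQ ⟨L t₀ c, h1⟩
      rw [this] at h2
      exact congrArg Subtype.val h2
    have h4 : (c : V) ∈ K := by
      rw [hK, hP t₀ ht₀, LinearMap.mem_ker]
      exact h3
    have h5 : (c : V) ∈ K ⊓ C := ⟨h4, c.2⟩
    rw [hKC.inf_eq_bot, Submodule.mem_bot] at h5
    exact Subtype.ext h5
  have hAsurj₀ : Function.Surjective (A t₀) := by
    rintro ⟨y, hy⟩
    obtain ⟨v, rfl⟩ := LinearMap.mem_range.1 hy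
    obtain ⟨u, hu, c, hc, huc⟩ := Submodule.mem_sup.1 (hKC.sup_eq_top ▸ Submodule.mem_top (x := v))
    refine ⟨⟨c, hc⟩, ?_⟩
    have hLu : L t₀ u = 0 := by
      rw [hK, hP t₀ ht₀] at hu
      exact hu
    have hLv : L t₀ v = L t₀ c := by rw [← huc, map_add, hLu, zero_add]
    apply Subtype.ext
    have := hQ ⟨L t₀ v, LinearMap.mem_range_self _ _⟩
    simp only [hA, hM, ContinuousLinearMap.coe_comp, Submodule.coe_subtypeL, Submodule.coe_subtype,
      Function.comp_apply]
    rw [← hLv, this]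
    rfl
  set A₀ : C ≃L[ℂ] R₀ :=
    (LinearEquiv.ofBijective (A t₀ : C →ₗ[ℂ] R₀) ⟨hAinj₀, hAsurj₀⟩).toContinuousLinearEquiv with hA₀
  have hA₀apply : ∀ c, A₀ c = A t₀ c := fun c ↦ rfl
  -- `B t = A₀⁻¹ ∘ A t : C → C`, a unit at `t₀`, continuous in `t`
  set B : (Fin d → ℂ) → C →L[ℂ] C := fun t ↦ (A₀.symm : R₀ →L[ℂ] C).comp (A t) with hB
  have hAc : ContinuousOn A U :=
    ((ContinuousLinearMap.compL ℂ C V R₀).flip C.subtypeL).continuous.comp_continuousOn hMc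
  have hBc : ContinuousOn B U :=
    (ContinuousLinearMap.compL ℂ C R₀ C (A₀.symm : R₀ →L[ℂ] C)).continuous.comp_continuousOn hAc
  have hB₀ : B t₀ = 1 := by
    ext c
    simp only [hB, ContinuousLinearMap.coe_comp, Function.comp_apply, ContinuousLinearMap.one_def,
      ContinuousLinearMap.coe_id', id_eq]
    rw [← hA₀apply, ContinuousLinearEquiv.coe_coe, A₀.symm_apply_apply]
  -- the open set `U₀` where `B t` is invertible
  haveI : CompleteSpace C := FiniteDimensional.complete ℂ C
  set U₀ : Set (Fin d → ℂ) := U ∩ B ⁻¹' {x | IsUnit x} with hU₀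
  have hU₀o : IsOpen U₀ := hBc.isOpen_inter_preimage hU (Units.isOpen (R := C →L[ℂ] C))
  have ht₀U₀ : t₀ ∈ U₀ := ⟨ht₀, by simp [hB₀]⟩
  have hU₀U : U₀ ⊆ U := inter_subset_left
  -- on `U₀`: `A t` is injective, `P t = ker (M t)`, and `P t ⊓ C = ⊥`
  have hAinj : ∀ t ∈ U₀, Function.Injective (A t) := by
    rintro t ⟨-, ht⟩
    obtain ⟨u, hu⟩ := (ht : IsUnit (B t))
    have hBinj : Function.Injective (B t) := by
      rw [← hu]
      intro c c' h
      have h1 : ∀ x, ((u⁻¹ : (C →L[ℂ] C)ˣ) : C →L[ℂ] C) ((u : C →L[ℂ] C) x) = x := fun x ↦ by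
        change ((u⁻¹ * u : (C →L[ℂ] C)ˣ) : C →L[ℂ] C) x = x
        rw [inv_mul_cancel]
        rfl
      rw [← h1 c, ← h1 c', h]
    intro c c' h
    apply hBinj
    simp only [hB, ContinuousLinearMap.coe_comp, Function.comp_apply, h]
  have hPeq : ∀ t ∈ U₀, P t = LinearMap.ker (M t : V →ₗ[ℂ] R₀) := by
    intro t ht
    haveI : FiniteDimensional ℂ (LinearMap.ker (M t : V →ₗ[ℂ] R₀)) := inferInstance
    refine Submodule.eq_of_le_of_finrank_le (hMker t (hU₀U ht)) ?_
    -- `dim ker (M t) ≤ r` since `M t` is injective on `C`, `dim C = dim V - r`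
    have hKr : finrank ℂ K = r := hr t₀ ht₀
    have hdimC : finrank ℂ K + finrank ℂ C = finrank ℂ V := by
      rw [← Submodule.finrank_sup_add_finrank_inf_eq K C, hKC.sup_eq_top, hKC.inf_eq_bot,
        finrank_top, finrank_bot, add_zero]
    have hrange : finrank ℂ C ≤ finrank ℂ (LinearMap.range (M t : V →ₗ[ℂ] R₀)) := by
      have : LinearMap.range (A t : C →ₗ[ℂ] R₀) ≤ LinearMap.range (M t : V →ₗ[ℂ] R₀) := by
        rintro _ ⟨c, rfl⟩
        exact ⟨c, rfl⟩
      calc finrank ℂ C = finrank ℂ (LinearMap.range (A t : C →ₗ[ℂ] R₀)) :=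
            (LinearMap.finrank_range_of_inj (hAinj t ht)).symm
        _ ≤ _ := Submodule.finrank_mono this
    have hrn := LinearMap.finrank_range_add_finrank_ker (M t : V →ₗ[ℂ] R₀)
    rw [hr t (hU₀U ht)]
    omega
  have hPC : ∀ t ∈ U₀, P t ⊓ C = ⊥ := by
    intro t ht
    rw [eq_bot_iff]
    rintro v ⟨hv, hvC⟩
    rw [hPeq t ht, SetLike.mem_coe, LinearMap.mem_ker] at hv
    have : A t ⟨v, hvC⟩ = 0 := by
      apply Subtype.ext
      simpa [hA] using congrArg Subtype.val hv
    have h0 := hAinj t ht (this.trans (map_zero _).symm)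
    simpa using congrArg Subtype.val h0
  -- the graph map `φ t : K → C`
  set φ : (Fin d → ℂ) → K →L[ℂ] C :=
    fun t ↦ -((Ring.inverse (B t)).comp ((A₀.symm : R₀ →L[ℂ] C).comp ((M t).comp K.subtypeL)))
    with hφ
  have hφc : ContinuousOn φ U₀ := by
    have h1 : ContinuousOn (fun t ↦ Ring.inverse (B t)) U₀ := by
      intro t ht
      obtain ⟨u, hu⟩ := ht.2
      have hca : ContinuousAt Ring.inverse (B t) := by
        rw [← hu]; exact NormedRing.inverse_continuousAt (R := C →L[ℂ] C) u
      exact hca.comp_continuousWithinAt ((hBc t ht.1).mono hU₀U)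
    have h2 : ContinuousOn (fun t ↦ (A₀.symm : R₀ →L[ℂ] C).comp ((M t).comp K.subtypeL)) U₀ :=
      ((ContinuousLinearMap.compL ℂ K R₀ C (A₀.symm : R₀ →L[ℂ] C)).continuous.comp
        ((ContinuousLinearMap.compL ℂ K V R₀).flip K.subtypeL).continuous).comp_continuousOn
        (hMc.mono hU₀U)
    exact (h1.clm_comp h2).neg
  -- `u + φ t u ∈ P t` for `u ∈ K`, `t ∈ U₀`
  have hmem : ∀ t ∈ U₀, ∀ u : K, (u : V) + (φ t u : V) ∈ P t := by
    intro t ht u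
    obtain ⟨unit, hunit⟩ := ht.2
    rw [hPeq t ht, LinearMap.mem_ker, ContinuousLinearMap.coe_coe, map_add]
    -- `M t (φ t u) = A t (φ t u) = A₀ (B t (φ t u)) = - M t u`
    have hAB : ∀ c : C, (M t c : R₀) = A₀ (B t c) := fun c ↦ by
      simp only [hB, ContinuousLinearMap.coe_comp, Function.comp_apply, ContinuousLinearEquiv.coe_coe,
        ContinuousLinearEquiv.apply_symm_apply]
      rfl
    have hBinv : ∀ c : C, B t (Ring.inverse (B t) c) = c := fun c ↦ by
      rw [← hunit, Ring.inverse_unit]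
      change (unit * unit⁻¹ : (C →L[ℂ] C)ˣ).val c = c
      rw [mul_inv_cancel]; rfl
    have : (M t (φ t u : V) : R₀) = -(M t u) := by
      rw [hAB]
      simp only [hφ, neg_apply, ContinuousLinearMap.coe_comp, Function.comp_apply,
        Submodule.coe_subtypeL, Submodule.coe_subtype, map_neg]
      rw [hBinv, ContinuousLinearEquiv.coe_coe, A₀.apply_symm_apply]
    rw [this, add_neg_cancel]
  -- the frame: a basis of `K` moved along the graph
  have hKr : finrank ℂ K = r := hr t₀ ht₀
  let bK : Basis (Fin r) ℂ K := Module.finBasisOfFinrankEq ℂ K hKr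
  set w : Fin r → (Fin d → ℂ) → V := fun i t ↦ (bK i : V) + (φ t (bK i) : V) with hw
  -- linear independence: project to `K` along `C`
  have hwli : ∀ t ∈ U₀, LinearIndependent ℂ (fun i ↦ w i t) := by
    intro t _
    have hproj : ∀ i, K.projectionOnto C hKC (w i t) = bK i := fun i ↦ by
      simp only [hw, map_add, Submodule.projectionOnto_apply_left,
        Submodule.projectionOnto_apply_right, add_zero]
    refine LinearIndependent.of_comp (K.projectionOnto C hKC) ?_
    convert bK.linearIndependent using 1
    ext i
    exact congrArg Subtype.val (hproj i) |>.trans rfl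
  have hwspan : ∀ t ∈ U₀, Submodule.span ℂ (Set.range fun i ↦ w i t) = P t := by
    intro t ht
    haveI : FiniteDimensional ℂ (P t) := inferInstance
    apply Submodule.eq_of_le_of_finrank_eq
    · rw [Submodule.span_le]
      rintro _ ⟨i, rfl⟩
      exact hmem t ht (bK i)
    · rw [finrank_span_eq_card (hwli t ht), Fintype.card_fin, hr t (hU₀U ht)]
  -- analyticity: each `φ · (bK i)` is `ℂ`-differentiable on `U₀`
  have hφdiff : ∀ i, DifferentiableOn ℂ (fun t ↦ (φ t (bK i) : C)) U₀ := by
    intro i t ht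
    obtain ⟨m, ℓ, hℓsep, hℓ⟩ := hdiff t (hU₀U ht)
    have hsepC : ∀ c : C, (∀ j, (ℓ j).comp C.subtypeL c = 0) → c = 0 := by
      intro c hc
      have h1 : (c : V) ∈ P t := hℓsep c fun j ↦ by simpa using hc j
      have h2 : (c : V) ∈ P t ⊓ C := ⟨h1, c.2⟩
      rw [hPC t ht, Submodule.mem_bot] at h2
      exact Subtype.ext h2
    have hσc : ContinuousAt (w i) t := by
      have : ContinuousAt (fun t' ↦ (φ t' (bK i) : C)) t :=
        ((ContinuousLinearMap.apply ℂ C (bK i)).continuous.comp_continuousOn hφc).continuousAt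
          (hU₀o.mem_nhds (x := t) ht)
      exact continuousAt_const.add (continuous_subtype_val.continuousAt.comp this)
    have hσmem : ∀ᶠ t' in 𝓝 t, w i t' ∈ P t' :=
      (hU₀o.eventually_mem ht).mono fun t' ht' ↦ hmem t' ht' (bK i)
    have hdj : ∀ j, DifferentiableAt ℂ (fun t' ↦ (ℓ j).comp C.subtypeL (φ t' (bK i))) t := by
      intro j
      have h := hℓ j (w i) hσc hσmem
      have heq : (fun t' ↦ (ℓ j).comp C.subtypeL (φ t' (bK i))) =
          fun t' ↦ ℓ j (w i t') - ℓ j (bK i : V) := by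
        funext t'
        simp [hw, map_add]
      rw [heq]
      exact h.sub_const _
    exact (differentiableAt_of_forall_clm (fun j ↦ (ℓ j).comp C.subtypeL) hsepC hdj).differentiableWithinAt
  have hwan : ∀ i, AnalyticOnNhd ℂ (w i) U₀ := by
    intro i
    have h1 : AnalyticOnNhd ℂ (fun t ↦ (φ t (bK i) : C)) U₀ :=
      analyticOnNhd_of_differentiableOn_of_finiteDimensional hU₀o (hφdiff i)
    have h2 : AnalyticOnNhd ℂ (fun t ↦ ((φ t (bK i) : C) : V)) U₀ :=
      (C.subtypeL.analyticOnNhd _).comp h1 (mapsTo_univ _ _)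
    exact analyticOnNhd_const.add h2
  exact ⟨U₀, hU₀o, ht₀U₀, hU₀U, w, hwan, fun t ht ↦ ⟨hwli t ht, hwspan t ht⟩⟩

end Literature.Analysis.Complex

end
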